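import Summits.CriticalPhenomena.PercolationContinuityZ3.Theorems.PercAnnulusCrossingIICVolumeTailTuples
import Summits.CriticalPhenomena.PercolationContinuityZ3.Theorems.PercAnnulusCrossingIICTypicalScalesFat
import HarnessLib

/-!
# The volume of Kesten's IIC has an exponential upper tail, IV-a: the ordered lattice sum on ANY finite set; the far ball `Λ_x(m)`; Markov (lane RSW3, p1 gen 28)

builds on p205010 (kernel theorem, internal audit signed; external expert review pending) — NOT used in this file (every `p`; deterministic).

RSW3 lane (LANE 3 `prim-rsw3`), seat `prim-rsw3-p1` (gen 28).  Helper file (`--supports stmt-CriticalPhenomena-4575`); no definitions,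
no sorries.  Memo `run/shared/lean/prim/rsw3/P1-QM.md` §41.

Part I (`…IICVolumeTailTuples`) summed the ordered weight `W→(q) = ∏_a π(D_a(q))` over tuples in `Λ(n)`.  Here the same peeling is done on
an ARBITRARY finite set `T` with two parameters — the price of the first point `Ξ_T = Σ_{y ∈ T} π(‖y‖)` (attachment to the root) and the
price of a further point `Θ ≥ sup_{w ∈ T} Σ_{y ∈ T} π(‖y − w‖)` — and the parameters are computed for the far ball `T = Λ_x(m)`:

* `sum_head_weight_le_of_forall`, **`sum_piFinset_orderedWeight_le_prod_range`** — **`Σ_{q : Fin t → T} W→(q) ≤ ∏_{i<t} (Ξ_T + iΘ)`**;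
* `prod_range_succ_le_factorial` — `∏_{i ≤ t} (Ξ + iΘ) ≤ Ξ·(t+1)!·(Ξ + Θ)^t`;
* `sum_ball_shift_oneArmProb_sub_le`, `sum_ball_shift_oneArmProb_le` — for `T = Λ_x(m)`: `Θ = Σ_{Λ(2m)} π(‖z‖)`, `Ξ_T ≤ (2m+1)^d·π(‖x‖ − m)`;
* `pow_mul_real_le_integral_card_pow` — Markov for powers of `#{y ∈ T : 0 ↔ y}` (any finite measure, any finite `T`).
Part IV-b (`…IICFarBallVolumeTail`): all moments of the IIC mass in a far ball with ONE visit price, and the exponential tail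
`ν(#(C(0) ∩ Λ_x(m)) ≥ λ(2m+1)^d π(m)) ≤ C (π(‖x‖)/π(m)) e^{−cλ}`.
References: H. Kesten, Probab. Theory Relat. Fields 73 (1986) Thm. (8), (46)–(47) [Kesten1986].
-/

noncomputable section

namespace Summit.CriticalPhenomena.PercolationContinuityZ3.Theorems.Crossing

open MeasureTheory Filter Topology Literature.Probability.Percolation Literature.Probability.LatticeModels
open Literature.Probability.Percolation.DCT16
open Summit.CriticalPhenomena.PercolationContinuityZ3.Theorems.SurfaceTension
open Summit.CriticalPhenomena.PercolationContinuityZ3.Theorems.Rsw3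

variable {d : ℕ}

/-! ## §1 The ordered lattice sum on an arbitrary finite set -/

/-- **One more (first) point on a finite set `T`**: if `Σ_{y ∈ T} π(‖y − w‖) ≤ Θ` for every `w ∈ T` (`Θ ≥ 0`), then for `q : Fin t → T`,
`Σ_{x ∈ T} π(D_0(cons x q)) ≤ Σ_{y ∈ T} π(‖y‖) + t·Θ` (attach to the root, or to one of the `≤ t` later points). [folklore] -/
theorem sum_head_weight_le_of_forall (p : unitInterval) {T : Finset (Site d)} {Θ : ℝ} (hΘ0 : 0 ≤ Θ)
    (hΘ : ∀ w ∈ T, ∑ y ∈ T, oneArmProb d p (Site.supNorm (y - w)) ≤ Θ) {t : ℕ} {q : Fin t → Site d}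
    (hq : q ∈ Fintype.piFinset (fun _ : Fin t => T)) :
    ∑ x ∈ T, oneArmProb d p (((insert (0 : Site d) (Finset.univ.image q)).inf
        (fun w => ((Site.supNorm (x - w) : ℕ) : ℕ∞))).toNat) ≤
      ∑ y ∈ T, oneArmProb d p (Site.supNorm y) + (t : ℝ) * Θ := by
  classical
  set S : Finset (Site d) := Finset.univ.image q with hS
  have hπ0 : ∀ m, 0 ≤ oneArmProb d p m := fun m => measureReal_nonneg
  have hSq : ∀ w ∈ S, w ∈ T := by
    intro w hw
    obtain ⟨b, -, rfl⟩ := Finset.mem_image.1 hw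
    exact Fintype.mem_piFinset.1 hq b
  have hScard : (S.card : ℝ) ≤ t := by
    have := Finset.card_image_le (s := (Finset.univ : Finset (Fin t))) (f := q)
    rw [Finset.card_univ, Fintype.card_fin] at this
    exact_mod_cast this
  have hΞ0 : 0 ≤ ∑ y ∈ T, oneArmProb d p (Site.supNorm y) := Finset.sum_nonneg fun y _ => hπ0 _
  -- the sum over the later points
  have hlater : ∑ w ∈ S, ∑ x ∈ T, oneArmProb d p (Site.supNorm (x - w)) ≤ (t : ℝ) * Θ := by
    calc ∑ w ∈ S, ∑ x ∈ T, oneArmProb d p (Site.supNorm (x - w)) ≤ ∑ _w ∈ S, Θ :=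
          Finset.sum_le_sum fun w hw => hΘ w (hSq w hw)
      _ = (S.card : ℝ) * Θ := by rw [Finset.sum_const, nsmul_eq_mul]
      _ ≤ (t : ℝ) * Θ := mul_le_mul_of_nonneg_right hScard hΘ0
  have h1 : ∑ x ∈ T, oneArmProb d p (((insert (0 : Site d) S).inf (fun w => ((Site.supNorm (x - w) : ℕ) : ℕ∞))).toNat) ≤
      ∑ w ∈ insert (0 : Site d) S, ∑ x ∈ T, oneArmProb d p (Site.supNorm (x - w)) := by
    rw [Finset.sum_comm]
    exact Finset.sum_le_sum fun x _ => apply_inf_toNat_le_sum ⟨0, Finset.mem_insert_self _ _⟩ x hπ0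
  refine h1.trans ?_
  by_cases h0 : (0 : Site d) ∈ S
  · rw [Finset.insert_eq_of_mem h0]
    linarith [hlater]
  · rw [Finset.sum_insert h0]
    simp only [sub_zero]
    linarith [hlater]

/-- **THE ORDERED LATTICE SUM ON A FINITE SET**: under `Σ_{y ∈ T} π(‖y − w‖) ≤ Θ` (`w ∈ T`, `Θ ≥ 0`),
**`Σ_{q : Fin t → T} W→(q) ≤ ∏_{i<t} (Ξ_T + i·Θ)`**, `Ξ_T = Σ_{y ∈ T} π(‖y‖)`, `W→(q) = ∏_a π(D_a(q))` (peel the first point).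
[cite: Kesten1986, Thm. (8), (46)–(47)] -/
theorem sum_piFinset_orderedWeight_le_prod_range (p : unitInterval) {T : Finset (Site d)} {Θ : ℝ} (hΘ0 : 0 ≤ Θ)
    (hΘ : ∀ w ∈ T, ∑ y ∈ T, oneArmProb d p (Site.supNorm (y - w)) ≤ Θ) (t : ℕ) :
    ∑ q ∈ Fintype.piFinset (fun _ : Fin t => T),
        ∏ a : Fin t, oneArmProb d p (((insert (0 : Site d) ((Finset.univ.filter fun b : Fin t => a < b).image q)).inf
          (fun w => ((Site.supNorm (q a - w) : ℕ) : ℕ∞))).toNat) ≤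
      ∏ i ∈ Finset.range t, (∑ y ∈ T, oneArmProb d p (Site.supNorm y) + (i : ℝ) * Θ) := by
  classical
  set Ξ : ℝ := ∑ y ∈ T, oneArmProb d p (Site.supNorm y) with hΞ
  have hπ0 : ∀ m, 0 ≤ oneArmProb d p m := fun m => measureReal_nonneg
  have hΞ0 : 0 ≤ Ξ := Finset.sum_nonneg fun y _ => hπ0 _
  induction t with
  | zero =>
    rw [sum_piFinset_zero_const T (1 : ℝ) _ fun q => by rw [Finset.univ_eq_empty, Finset.prod_empty]]
    simp
  | succ t ih =>
    rw [sum_piFinset_succ_const, Finset.prod_range_succ]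
    have hstep : ∀ x ∈ T, ∑ q ∈ Fintype.piFinset (fun _ : Fin t => T),
        ∏ a : Fin (t + 1), oneArmProb d p (((insert (0 : Site d)
          ((Finset.univ.filter fun b : Fin (t + 1) => a < b).image (Fin.cons x q : Fin (t + 1) → Site d))).inf
            (fun w => ((Site.supNorm ((Fin.cons x q : Fin (t + 1) → Site d) a - w) : ℕ) : ℕ∞))).toNat) =
        ∑ q ∈ Fintype.piFinset (fun _ : Fin t => T),
          oneArmProb d p (((insert (0 : Site d) (Finset.univ.image q)).inf (fun w => ((Site.supNorm (x - w) : ℕ) : ℕ∞))).toNat) *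
            ∏ a : Fin t, oneArmProb d p (((insert (0 : Site d) ((Finset.univ.filter fun b : Fin t => a < b).image q)).inf
              (fun w => ((Site.supNorm (q a - w) : ℕ) : ℕ∞))).toNat) :=
      fun x _ => Finset.sum_congr rfl fun q _ => prod_orderedWeight_cons (oneArmProb d p) x q
    rw [Finset.sum_congr rfl hstep, Finset.sum_comm]
    have hW0 : ∀ q : Fin t → Site d, 0 ≤ ∏ a : Fin t, oneArmProb d p (((insert (0 : Site d)
        ((Finset.univ.filter fun b : Fin t => a < b).image q)).inf (fun w => ((Site.supNorm (q a - w) : ℕ) : ℕ∞))).toNat) :=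
      fun q => Finset.prod_nonneg fun a _ => hπ0 _
    have hP0 : 0 ≤ ∏ i ∈ Finset.range t, (Ξ + (i : ℝ) * Θ) :=
      Finset.prod_nonneg fun i _ => add_nonneg hΞ0 (mul_nonneg (Nat.cast_nonneg i) hΘ0)
    calc ∑ q ∈ Fintype.piFinset (fun _ : Fin t => T), ∑ x ∈ T,
          oneArmProb d p (((insert (0 : Site d) (Finset.univ.image q)).inf (fun w => ((Site.supNorm (x - w) : ℕ) : ℕ∞))).toNat) *
            ∏ a : Fin t, oneArmProb d p (((insert (0 : Site d) ((Finset.univ.filter fun b : Fin t => a < b).image q)).inf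
              (fun w => ((Site.supNorm (q a - w) : ℕ) : ℕ∞))).toNat)
        = ∑ q ∈ Fintype.piFinset (fun _ : Fin t => T),
            (∑ x ∈ T, oneArmProb d p (((insert (0 : Site d) (Finset.univ.image q)).inf
              (fun w => ((Site.supNorm (x - w) : ℕ) : ℕ∞))).toNat)) *
            ∏ a : Fin t, oneArmProb d p (((insert (0 : Site d) ((Finset.univ.filter fun b : Fin t => a < b).image q)).inf
              (fun w => ((Site.supNorm (q a - w) : ℕ) : ℕ∞))).toNat) := by
          refine Finset.sum_congr rfl fun q _ => ?_
          rw [Finset.sum_mul]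
      _ ≤ ∑ q ∈ Fintype.piFinset (fun _ : Fin t => T), (Ξ + (t : ℝ) * Θ) *
            ∏ a : Fin t, oneArmProb d p (((insert (0 : Site d) ((Finset.univ.filter fun b : Fin t => a < b).image q)).inf
              (fun w => ((Site.supNorm (q a - w) : ℕ) : ℕ∞))).toNat) :=
          Finset.sum_le_sum fun q hq => mul_le_mul_of_nonneg_right (sum_head_weight_le_of_forall p hΘ0 hΘ hq) (hW0 q)
      _ = (Ξ + (t : ℝ) * Θ) * ∑ q ∈ Fintype.piFinset (fun _ : Fin t => T),
            ∏ a : Fin t, oneArmProb d p (((insert (0 : Site d) ((Finset.univ.filter fun b : Fin t => a < b).image q)).inf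
              (fun w => ((Site.supNorm (q a - w) : ℕ) : ℕ∞))).toNat) := (Finset.mul_sum _ _ _).symm
      _ ≤ (Ξ + (t : ℝ) * Θ) * ∏ i ∈ Finset.range t, (Ξ + (i : ℝ) * Θ) :=
          mul_le_mul_of_nonneg_left ih (add_nonneg hΞ0 (mul_nonneg (Nat.cast_nonneg t) hΘ0))
      _ = (∏ i ∈ Finset.range t, (Ξ + (i : ℝ) * Θ)) * (Ξ + (t : ℝ) * Θ) := mul_comm _ _

/-- `∏_{i ≤ t} (Ξ + iΘ) ≤ Ξ · (t+1)! · (Ξ + Θ)^t` for `Ξ, Θ ≥ 0` (`Ξ + iΘ ≤ (i+1)(Ξ + Θ)` for `i ≥ 1`). [folklore] -/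
theorem prod_range_succ_le_factorial {Ξ Θ : ℝ} (hΞ : 0 ≤ Ξ) (hΘ : 0 ≤ Θ) (t : ℕ) :
    ∏ i ∈ Finset.range (t + 1), (Ξ + (i : ℝ) * Θ) ≤ Ξ * (((t + 1).factorial : ℕ) : ℝ) * (Ξ + Θ) ^ t := by
  induction t with
  | zero => simp
  | succ t ih =>
    rw [Finset.prod_range_succ]
    have h1 : Ξ + ((t + 1 : ℕ) : ℝ) * Θ ≤ ((t + 2 : ℕ) : ℝ) * (Ξ + Θ) := by
      push_cast; nlinarith
    have h0 : 0 ≤ Ξ + ((t + 1 : ℕ) : ℝ) * Θ := by positivity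
    calc (∏ i ∈ Finset.range (t + 1), (Ξ + (i : ℝ) * Θ)) * (Ξ + ((t + 1 : ℕ) : ℝ) * Θ)
        ≤ (Ξ * (((t + 1).factorial : ℕ) : ℝ) * (Ξ + Θ) ^ t) * (((t + 2 : ℕ) : ℝ) * (Ξ + Θ)) :=
          mul_le_mul ih h1 h0 (by positivity)
      _ = Ξ * (((t + 1 + 1).factorial : ℕ) : ℝ) * (Ξ + Θ) ^ (t + 1) := by
          rw [Nat.factorial_succ (t + 1)]; push_cast; ring

/-! ## §2 The far ball `Λ_x(m)`: the two parameters -/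

/-- For `w ∈ Λ_x(m)`: `Σ_{y ∈ Λ_x(m)} π(‖y − w‖) ≤ Σ_{z ∈ Λ(2m)} π(‖z‖)` (translate and `sum_box_sub_le_sum_box_two_mul`). [folklore] -/
theorem sum_ball_shift_oneArmProb_sub_le (p : unitInterval) (m : ℕ) (x : Site d) {w : Site d} (hw : w ∈ (box d m).image (· + x)) :
    ∑ y ∈ (box d m).image (· + x), oneArmProb d p (Site.supNorm (y - w)) ≤ ∑ z ∈ box d (2 * m), oneArmProb d p (Site.supNorm z) := by
  classical
  obtain ⟨w₀, hw₀, rfl⟩ := Finset.mem_image.1 hw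
  have hinj : Set.InjOn (fun y : Site d => y + x) ↑(box d m) := fun a _ b _ h => add_right_cancel h
  rw [Finset.sum_image hinj]
  have h : ∀ y ∈ box d m, oneArmProb d p (Site.supNorm (y + x - (w₀ + x))) = oneArmProb d p (Site.supNorm (y - w₀)) := by
    intro y _; congr 2; abel
  rw [Finset.sum_congr rfl h]
  exact sum_box_sub_le_sum_box_two_mul hw₀ (g := fun z => oneArmProb d p (Site.supNorm z)) fun z => measureReal_nonneg

/-- `Σ_{y ∈ Λ_x(m)} π(‖y‖) ≤ (2m+1)^d · π(‖x‖ − m)` (`‖y‖ ≥ ‖x‖ − m` on `Λ_x(m)`, `π` antitone, `|Λ(m)| = (2m+1)^d`). [folklore] -/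
theorem sum_ball_shift_oneArmProb_le (p : unitInterval) (m : ℕ) (x : Site d) :
    ∑ y ∈ (box d m).image (· + x), oneArmProb d p (Site.supNorm y) ≤
      ((2 * m + 1 : ℕ) : ℝ) ^ d * oneArmProb d p (Site.supNorm x - m) := by
  classical
  have hterm : ∀ y ∈ (box d m).image (· + x), oneArmProb d p (Site.supNorm y) ≤ oneArmProb d p (Site.supNorm x - m) := by
    intro y hy
    obtain ⟨y₀, hy₀, rfl⟩ := Finset.mem_image.1 hy
    have h1 : Site.supNorm y₀ ≤ m := mem_box_iff_supNorm_le.1 hy₀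
    have h2 : Site.supNorm x ≤ Site.supNorm (y₀ + x) + Site.supNorm y₀ := by
      have h := Site.supNorm_add_le (y₀ + x) (-y₀)
      rwa [Site.supNorm_neg, add_neg_cancel_comm] at h
    exact real_siteToBoundary_antitone p (by omega)
  have hcard : (((box d m).image (· + x)).card : ℝ) ≤ ((2 * m + 1 : ℕ) : ℝ) ^ d := by
    have h := Finset.card_image_le (s := box d m) (f := fun y : Site d => y + x)
    rw [card_box] at h
    exact_mod_cast h
  calc ∑ y ∈ (box d m).image (· + x), oneArmProb d p (Site.supNorm y)
      ≤ ∑ _y ∈ (box d m).image (· + x), oneArmProb d p (Site.supNorm x - m) := Finset.sum_le_sum hterm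
    _ = (((box d m).image (· + x)).card : ℝ) * oneArmProb d p (Site.supNorm x - m) := by rw [Finset.sum_const, nsmul_eq_mul]
    _ ≤ ((2 * m + 1 : ℕ) : ℝ) ^ d * oneArmProb d p (Site.supNorm x - m) := mul_le_mul_of_nonneg_right hcard measureReal_nonneg

/-! ## §3 Markov for powers of a count on a finite set -/

open Classical in
/-- **Markov for powers of the count `#{y ∈ T : 0 ↔ y}`** (any finite measure, any finite `T`, `a ≥ 0`):
`a^t · ν{a ≤ #} ≤ ∫ #^t dν`. [folklore] -/
theorem pow_mul_real_le_integral_card_pow (ν : Measure (BondConfig (Site d))) [IsFiniteMeasure ν] (T : Finset (Site d)) (t : ℕ)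
    {a : ℝ} (ha : 0 ≤ a) :
    a ^ t * ν.real {ω | a ≤ (((T.filter fun y => ω ∈ (openConn (0 : Site d) y : Set (BondConfig (Site d)))).card : ℕ) : ℝ)} ≤
      ∫ ω, (((T.filter fun y => ω ∈ (openConn (0 : Site d) y : Set (BondConfig (Site d)))).card : ℕ) : ℝ) ^ t ∂ν := by
  classical
  set V : BondConfig (Site d) → ℝ := fun ω =>
    (((T.filter fun y => ω ∈ (openConn (0 : Site d) y : Set (BondConfig (Site d)))).card : ℕ) : ℝ) with hV
  have hVm : Measurable V := measurable_card_filter_openConn_finset T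
  have hV0 : ∀ ω, 0 ≤ V ω := fun ω => by simp only [hV]; exact Nat.cast_nonneg _
  have hVle : ∀ ω, V ω ≤ (T.card : ℝ) := fun ω => by
    simp only [hV]; exact_mod_cast Finset.card_filter_le _ _
  have hint : Integrable (fun ω => V ω ^ t) ν := by
    refine (integrable_const ((T.card : ℝ) ^ t)).mono' (hVm.pow_const t).aestronglyMeasurable
      (Filter.Eventually.of_forall fun ω => ?_)
    rw [Real.norm_eq_abs, abs_of_nonneg (pow_nonneg (hV0 ω) t)]
    exact pow_le_pow_left₀ (hV0 ω) (hVle ω) t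
  have hmarkov := mul_meas_ge_le_integral_of_nonneg (μ := ν) (f := fun ω => V ω ^ t)
    (Filter.Eventually.of_forall fun ω => pow_nonneg (hV0 ω) t) hint (a ^ t)
  refine le_trans (mul_le_mul_of_nonneg_left ?_ (pow_nonneg ha t)) hmarkov
  exact measureReal_mono (fun ω hω => pow_le_pow_left₀ ha hω t) (measure_ne_top ν _)

end Summit.CriticalPhenomena.PercolationContinuityZ3.Theorems.Crossing

end
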